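import Mathlib
import Summits.Ventures.LatticeQCDFlow.TrivializingMaps.CasimirGrading

/-!
HONEST FRAMING: exact (Metropolis-corrected) sampling algorithms for lattice gauge theory; figures of
merit are autocorrelation/cost numbers at stated couplings and volumes; no continuum-physics claim.

# Joint gradings — the finite grading by joint eigenspaces of a commuting self-adjoint family

THEORY-1 §19 (GEN-10), fact (E3) made concrete.  For a finite family `C : E → (H →L[ℂ] H)` of pairwise
commuting self-adjoint operators on a finite-dimensional Hilbert space (in the application: the slot
Casimirs `C^{σ,e}` of `SlotCasimir.lean`, packaged on `H_σ = ℂ^{σ → Fin n}`), the JOINT MODES are the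
tuples `m = (m_e)_e` of eigenvalues, a FINITE index type `Modes C = Π e, Eigenvalues (C e)` (this is the
"Fintype index" point of THEORY-1 §19.5), the joint space of `m` is `⨅ₑ ker(C_e - m_e)`, and
`jointProj C m` is its orthogonal projection.  Proved: (G1) `jointProj C` is a grading in the sense of
`CasimirGrading.IsGrading` (complete: Mathlib's simultaneous diagonalisation
`LinearMap.IsSymmetric.iSup_iInf_eq_top_of_commute`; orthogonal: `orthogonalFamily_iInf_eigenspaces`);
(G2) every operator commuting with the family commutes with every `jointProj C m` (so `R_σ(U)` and the
generators `T_a^{σ,e'}` do, by (E6)); (G3) `C_e ∘ P_m = m_e • P_m`; (G4) the modes are real, and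
non-negative when `C_e` is a Casimir `∑ₐ X_a† X_a`.  With `IsGrading.inner_eq_sum` and
`IsGrading.sum_norm_mul_norm_le` of `CasimirGrading.lean` this is the re-grading step of the
Casimir-graded Lüscher recursion at constant `1` (THEORY-1 §19.3).  Mathlib only (+ `CasimirGrading`).
References: THEORY-1 §19; M. Lüscher, Commun. Math. Phys. 293 (2010) 899 [arXiv:0907.5491] §3 (the
recursion being graded).  Tags: [folklore] = finite-dimensional spectral theory, [ours] = bookkeeping.
-/

open scoped InnerProductSpace ComplexConjugate
open ContinuousLinearMap Module.End
open Summit.Ventures.LatticeQCDFlow.TrivializingMaps.CasimirGrading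

namespace Summit.Ventures.LatticeQCDFlow.TrivializingMaps.JointGrading

variable {H : Type*} [NormedAddCommGroup H] [InnerProductSpace ℂ H] {E : Type*}

/-- The **joint modes** of the family: one eigenvalue of each `C e` (a finite type). [folklore] -/
abbrev Modes (C : E → H →L[ℂ] H) : Type _ := Π e : E, Eigenvalues (C e : H →ₗ[ℂ] H)

/-- The **joint space** of the mode `m`: `⨅ₑ ker (C_e - m_e)`. [folklore] -/
def jointSpace (C : E → H →L[ℂ] H) (m : Modes C) : Submodule ℂ H :=
  ⨅ e, eigenspace (C e : H →ₗ[ℂ] H) (m e : ℂ)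

/-- Membership in the joint space: `C_e v = m_e v` for every `e`. [folklore] -/
theorem mem_jointSpace_iff {C : E → H →L[ℂ] H} {m : Modes C} {v : H} :
    v ∈ jointSpace C m ↔ ∀ e, C e v = (m e : ℂ) • v := by
  simp only [jointSpace, Submodule.mem_iInf, mem_eigenspace_iff, ContinuousLinearMap.coe_coe]

section Proj
variable [FiniteDimensional ℂ H]

/-- The **joint projection** `P_m`: orthogonal projection onto the joint space of `m`. [folklore] -/
noncomputable def jointProj (C : E → H →L[ℂ] H) (m : Modes C) : H →L[ℂ] H :=
  haveI : CompleteSpace (jointSpace C m) := FiniteDimensional.complete ℂ _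
  (jointSpace C m).starProjection

variable (C : E → H →L[ℂ] H)

/-- `P_m v` lies in the joint space. [folklore] -/
theorem jointProj_apply_mem (m : Modes C) (v : H) : jointProj C m v ∈ jointSpace C m := by
  haveI : CompleteSpace (jointSpace C m) := FiniteDimensional.complete ℂ _
  exact (jointSpace C m).starProjection_apply_mem v

/-- (G3) `C_e P_m = m_e P_m`. [folklore] -/
theorem apply_jointProj (e : E) (m : Modes C) (v : H) :
    C e (jointProj C m v) = (m e : ℂ) • jointProj C m v :=
  (mem_jointSpace_iff.1 (jointProj_apply_mem C m v)) e

/-- (G3, operator form) `C_e ∘ P_m = m_e • P_m`. [folklore] -/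
theorem comp_jointProj (e : E) (m : Modes C) : C e ∘L jointProj C m = (m e : ℂ) • jointProj C m := by
  ext v
  simp only [comp_apply, smul_apply, apply_jointProj]

end Proj

section ModeFacts
variable [CompleteSpace H] (C : E → H →L[ℂ] H)

/-- (G4) The modes of a self-adjoint family are real. [folklore] -/
theorem mode_conj (hC : ∀ e, IsSelfAdjoint (C e)) (m : Modes C) (e : E) : conj (m e : ℂ) = (m e : ℂ) :=
  (hC e).isSymmetric.conj_eigenvalue_eq_self (m e).property

/-- (G4) Real form of a mode. [folklore] -/
theorem mode_eq_re (hC : ∀ e, IsSelfAdjoint (C e)) (m : Modes C) (e : E) :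
    (m e : ℂ) = (((m e : ℂ).re : ℝ) : ℂ) :=
  (Complex.conj_eq_iff_re.1 (mode_conj C hC m e)).symm ▸ rfl

/-- (G4) The modes of a Casimir `C_e = ∑ₐ X_a† X_a` are non-negative. [folklore] -/
theorem mode_nonneg {ι : Type*} [Fintype ι] (X : ι → H →L[ℂ] H) (e : E) (hCe : C e = casimir X)
    (m : Modes C) : 0 ≤ (m e : ℂ).re := by
  obtain ⟨v, hv⟩ := Module.End.HasEigenvalue.exists_hasEigenvector (f := (C e : H →ₗ[ℂ] H)) (m e).property
  have hre : (m e : ℂ) = (((m e : ℂ).re : ℝ) : ℂ) := by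
    have hsa : IsSelfAdjoint (C e) := by
      rw [hCe, ContinuousLinearMap.isSelfAdjoint_iff', adjoint_casimir]
    have h := hsa.isSymmetric.conj_eigenvalue_eq_self (m e).property
    exact (Complex.conj_eq_iff_re.1 h).symm
  refine eigen_nonneg X (v := v) ?_ hv.2
  have h1 : (C e : H →ₗ[ℂ] H) v = (m e : ℂ) • v := hv.apply_eq_smul
  rw [ContinuousLinearMap.coe_coe] at h1
  rw [← hCe, h1]
  exact congrArg (· • v) hre

end ModeFacts

section Commute
variable [CompleteSpace H] [FiniteDimensional ℂ H] (C : E → H →L[ℂ] H)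

/-- (G2) **Operators commuting with the family commute with the joint projections** (the joint space and
its orthogonal complement are invariant, the latter because the adjoint commutes too). [folklore] -/
theorem jointProj_comm (hC : ∀ e, IsSelfAdjoint (C e)) {A : H →L[ℂ] H}
    (hA : ∀ e, A ∘L C e = C e ∘L A) (m : Modes C) : jointProj C m ∘L A = A ∘L jointProj C m := by
  haveI : CompleteSpace (jointSpace C m) := FiniteDimensional.complete ℂ _
  have hA' : ∀ e, adjoint A ∘L C e = C e ∘L adjoint A := by
    intro e
    have h := congrArg adjoint (hA e)
    rw [adjoint_comp, adjoint_comp, (hC e).adjoint_eq] at h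
    exact h.symm
  have hinv : ∀ (B : H →L[ℂ] H), (∀ e, B ∘L C e = C e ∘L B) → ∀ v ∈ jointSpace C m, B v ∈ jointSpace C m := by
    intro B hB v hv
    rw [mem_jointSpace_iff] at hv ⊢
    intro e
    have h := congrArg (fun F : H →L[ℂ] H => F v) (hB e)
    simp only [comp_apply] at h
    rw [← h, hv e, map_smul]
  have hK := hinv A hA
  have hKo : ∀ w ∈ (jointSpace C m)ᗮ, A w ∈ (jointSpace C m)ᗮ := by
    intro w hw
    rw [Submodule.mem_orthogonal] at hw ⊢
    intro u hu
    rw [← adjoint_inner_left]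
    exact hw _ (hinv (adjoint A) hA' u hu)
  ext v
  change (jointSpace C m).starProjection (A v) = A ((jointSpace C m).starProjection v)
  exact Submodule.eq_starProjection_of_mem_orthogonal' (hK _ ((jointSpace C m).starProjection_apply_mem v))
    (hKo _ ((jointSpace C m).sub_starProjection_mem_orthogonal v)) (by rw [← map_add, add_sub_cancel])

/-- (G2') In particular the joint projections commute with each member of the family. [folklore] -/
theorem jointProj_comm_self (hC : ∀ e, IsSelfAdjoint (C e)) (hCC : ∀ e e', C e ∘L C e' = C e' ∘L C e)
    (e : E) (m : Modes C) : jointProj C m ∘L C e = C e ∘L jointProj C m :=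
  jointProj_comm C hC (fun e' => hCC e e') m

end Commute

section Grading
variable [CompleteSpace H] [FiniteDimensional ℂ H] [Fintype E] [DecidableEq E] (C : E → H →L[ℂ] H)

/-- (G1) **The joint projections form a grading**: self-adjoint idempotents, pairwise orthogonal, summing
to the identity (finite-dimensional simultaneous diagonalisation of a commuting self-adjoint family,
indexed by the finite type of joint modes). [folklore] -/
theorem isGrading_jointProj (hC : ∀ e, IsSelfAdjoint (C e)) (hCC : ∀ e e', C e ∘L C e' = C e' ∘L C e) :
    IsGrading (jointProj C) := by
  haveI : ∀ m : Modes C, CompleteSpace (jointSpace C m) := fun m => FiniteDimensional.complete ℂ _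
  have hT : ∀ e, (C e : H →ₗ[ℂ] H).IsSymmetric := fun e => (hC e).isSymmetric
  have hinj : Function.Injective (fun m : Modes C => fun e => (m e : ℂ)) :=
    fun m m' h => funext fun e => Subtype.ext (congrFun h e)
  have hV : OrthogonalFamily ℂ (fun m : Modes C => jointSpace C m) fun m => (jointSpace C m).subtypeₗᵢ :=
    (LinearMap.IsSymmetric.orthogonalFamily_iInf_eigenspaces hT).comp hinj
  have hcomm : Pairwise (Function.onFun Commute fun e => (C e : H →ₗ[ℂ] H)) := by
    intro e e' _
    change (C e : H →ₗ[ℂ] H) * (C e' : H →ₗ[ℂ] H) = (C e' : H →ₗ[ℂ] H) * (C e : H →ₗ[ℂ] H)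
    refine LinearMap.ext fun v => ?_
    have h := congrArg (fun F : H →L[ℂ] H => F v) (hCC e e')
    simp only [comp_apply] at h
    simpa only [Module.End.mul_apply, ContinuousLinearMap.coe_coe] using h
  have htop : iSup (fun m : Modes C => jointSpace C m) = ⊤ := by
    have h1 := LinearMap.IsSymmetric.iSup_iInf_eq_top_of_commute hT hcomm
    refine top_le_iff.1 (h1 ▸ iSup_le fun χ => ?_)
    by_cases hχ : ∀ e, HasEigenvalue (C e : H →ₗ[ℂ] H) (χ e)
    · exact le_iSup_of_le (fun e => ⟨χ e, hχ e⟩) le_rfl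
    · obtain ⟨e, he⟩ := not_forall.1 hχ
      have hbot : eigenspace (C e : H →ₗ[ℂ] H) (χ e) = ⊥ := by
        simpa [hasEigenvalue_iff] using he
      exact (iInf_le _ e).trans (hbot ▸ bot_le)
  exact isGrading_starProjection (fun m => jointSpace C m) hV htop

/-- **Re-grading identity**: for `R` commuting with the family, `⟪R v, w⟫ = ∑ₘ ⟪R P_m v, P_m w⟫`, with the
re-graded masses controlled by `IsGrading.sum_norm_mul_norm_le` (`∑ₘ ‖P_m v‖ ‖P_m w‖ ≤ ‖v‖ ‖w‖`):
the step of the Casimir-graded recursion that costs the constant `1`. [ours] -/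
theorem inner_eq_sum_jointProj (hC : ∀ e, IsSelfAdjoint (C e)) (hCC : ∀ e e', C e ∘L C e' = C e' ∘L C e)
    {R : H →L[ℂ] H} (hR : ∀ e, R ∘L C e = C e ∘L R) (v w : H) :
    ⟪R v, w⟫_ℂ = ∑ m : Modes C, ⟪R (jointProj C m v), jointProj C m w⟫_ℂ :=
  (isGrading_jointProj C hC hCC).inner_eq_sum (fun m => (jointProj_comm C hC hR m).symm) v w

end Grading

end Summit.Ventures.LatticeQCDFlow.TrivializingMaps.JointGrading
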